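import Literature.MathematicalPhysics.QuantumFieldTheory.Balaban1983to89.B9Eq3115KnitLetterYNumerics
import Literature.MathematicalPhysics.QuantumFieldTheory.Balaban1983to89.B7Prop5CplxLevels

/-!
# `Balaban1983to89.B9Eq380KnitVariationYNumerics` — T. Bałaban, *Averaging operations for lattice gauge theories*, Commun. Math. Phys. **98** (1985) 17–51 [Balaban1985Averaging]
# Proposition 7 p. 43 ∕ Proposition 5 (145) p. 40 («α₀, α₁ sufficiently small»), with *Propagators …* CMP **99** (1985) [Balaban1985BackgroundPropagators] (3.81) p. 406, (3.58)
# p. 402: ★★★ **THE x-FREE PROP-7∕PROP-5 WINDOW OF THE KNIT VARIATION LAWS IS INHABITED AT EVERY `(d+1, ℓ+1)`, JOINTLY WITH THE KNIT-LETTER WINDOW** — witnesses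
# `α₀′ ≤ alpha0W d ℓ` (any, e.g. `B9Eq3115KnitLetterYNumerics`' capped `α_KW`), `ϱ′ = ϱ = α_K := bbW d ℓ` (this lineage's g34 `B7Prop5WindowNumerics` constants) for the displayed
# numerics of `B9Eq380QknitVariationY.norm_QknitY_mulY_sub_apply_le`, `BalabanUVNodesN06SectBQVarLawsKnit.hQ80_knit ∕ hQL280_knit` and
# `B9Eq358KnitTransporterVariationY.parVar337Y_parKnitY` (`hα8 hsmall′ hc₃′ hϱ′1 hE hdX hsmall hc₃ hsm`), packaged in ONE `∃` together with the knit-letter numerics of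
# `B9Eq3115KnitLetterYNumerics.knitWindow_inhabited_le` (`α_Q, C₀, c₂′, e^{…} < 2, K·α₀′ < 1`, plaquette threshold `K_pl(a)L⁴ < α₀′` unfolded ∕ folded)

statement-level skeleton of published theorems with citation tags; proofs where landed; nothing here is a claim about the Yang–Mills mass gap

CITATION HEADER (lean-in-tree rule).  Cell `pub-ymgap` (YM Track A, D-0062), node N06, seat `pub-ymgap-dag-n06-l` (gen 39; K1⁹ `stmt-QuantumFields-27364` SUPPORTS lane), rider of
programme «P-Q80-knit» (files `B7Prop7LinearKernelBackgroundModulus`, `B9Eq380QknitVariationY`, `B9SectBQVarLawsOfKernelY`, `Thm/…N06SectBQVarLawsKnit`,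
`B9Eq358KnitTransporterVariationY`): the KC∕KD certificate editions display those files' smallness hypotheses as x-free numerics; THIS FILE inhabits them once and for
all (jointly with the knit-letter window the same consumers already take from `B9Eq3115KnitLetterYNumerics.knitWindow_inhabited_le`, e.g. def-Y's
`Thm/…N06NumericsWitnessY`), so the consumer's `NumericsWitness` takes ONE `obtain`.  REUSED BY NAME: g34 `B7Prop5WindowNumerics.alpha0W ∕ bbW ∕ alpha0W_pos ∕ bbW_pos ∕
alpha0W_le_one_div ∕ bbW_le_one_div ∕ hsmall_b7W ∕ hc3_b7W ∕ c2'_succ ∕ c3_succ`, this seat's `B9Eq3115KnitLetterYNumerics.knitWindow_inhabited_le` (and through it `alphaKW`,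
`plaq_lt_of_le`, `Kpl_mul_lt_of_le`), p06 `B7Prop5CplxLevels.epsCplx ∕ tauCplx`, `B9Eq316AveragingTransposeZd.alphaQ`, `B9Eq3115KnitLetterYOnto.kCol`, def-Y `B9C2FormBoxRegimeY.Kpl`.

THE PRINT.  [5] p. 43: *«Proposition 7. For U₀ satisfying (52) and U′ = e^{iηA′}, |A′| < α₁, α₀, α₁ sufficiently small …»*; (145) p. 40 (the step condition of Prop. 5's
induction, «if … α₀, α₁ are sufficiently small»); [B9] p. 406: *«… for Mα₀, α₁ sufficiently small and with a constant O(1) depending on d and L only.»*  The tree's Prop-7∕Prop-5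
theorems (r04 `B7Prop7Levels`, p06 `B7Prop5Cplx`) carry «sufficiently small» as explicit inequalities in `(d, L, α₀, b′, b)`; at the knit pair (`B9Eq380QknitVariationY` §2) they
read, in coarse units `ϱ′ = Lʲρ′`, `ϱ = Lʲρ`: `hsmall′ : e^{4·800(d+2)²(d+5)α₀′}(1 + 8·131072(d+2)²ϱ′) ≤ 2`, `hc₃′ : 2ϱ′ ≤ c₃`, `hϱ′1 : 409600(d+2)²ϱ′ ≤ 1`, `hE : ε(ϱ′) ≤ 1∕16`,
`hdX : (d+1)(ε(ϱ′) + τ(α₀′, ϱ′)) ≤ 1∕16`, `hsmall : e^{4480(d+2)²(d+5)α₀′ + 240000(d+2)³ϱ′}(1 + 8·2097152(d+2)²ϱ) ≤ 2`, `hc₃ : 2ϱ ≤ c₃∕4`; and (`B9Eq358KnitTransporterVariationY`)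
`hsm : 4096(d+1)α_K ≤ 1`.

WHAT IS PROVED (sorry-free; 0 `def` — the witnesses are g34's `alpha0W`, `bbW`).  §1 casts and monomial slack, `e^x ≤ 1 + 2x` on `[0,1]`, the unfolded one-step numerics
`ε(ϱ′) = 4800L(d+2)²ϱ′`, `τ(α, ϱ′) = (4480(d+2)(d+5)L²α + 224000L(d+2)²ϱ′)L^{d+1}L⁻¹` (`L = ℓ+1`); §2 the nine inequalities at `ϱ′ := bbW` and ANY `0 ≤ α ≤ alpha0W` (the
`α`-dependent ones are monotone): `hα8_knitV`, `hsmall'_knitV`, `hc₃'_knitV`, `hc₃_knitV`, `hϱ'1_knitV`, `hE_knitV`, `hdX_knitV`, `hsmall_knitV`, `hsm_knitV`; §3 ★★★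
`knitVarWindow_inhabited_le` — for any `amax > 0`, `∃ α₀′ ∈ (0, amax], ϱ′ > 0, a₁ > 0` with the six knit-letter conjuncts of `knitWindow_inhabited_le`, the nine above at
`(α₀′, ϱ′)`, and the plaquette threshold `∀ a ∈ [0, a₁]` in both spellings (unfolded `2(10La)(1+10La)e^{40La}L⁴ < α₀′`; folded `Kpl i a·(kGeo i).L⁴ < α₀′` for every k-level index).

HONEST SCOPE.  Elementary real arithmetic (witness inequalities); crude, non-optimal witnesses; nothing of [5]∕[B9] asserted; count-neutral; N06 NOT discharged; K1⁹ NOT closed;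
nothing continuum ∕ OS ∕ mass-gap ∕ Clay — the Yang–Mills mass gap is NOT proved here.  NEW file; nothing landed is modified.  No `sorry`, no `axiom`, no `def`, no `instance`,
no `notation`.  Net new unproved facts: 0.
-/

noncomputable section

namespace Literature.MathematicalPhysics.QuantumFieldTheory.Balaban1983to89.B9Eq380KnitVariationYNumerics

open B7Prop2Explicit (C0 c2')
open B7Prop3Flat (c3)
open B7Prop5CplxLevels (epsCplx tauCplx)
open B7Prop5WindowNumerics (alpha0W bbW alpha0W_pos bbW_pos alpha0W_le_one_div bbW_le_one_div hsmall_b7W hc3_b7W c2'_succ c3_succ)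
open B9Eq3115KnitLetterYOnto (kCol) open B9C2FormBoxRegimeY (Kpl) open B6KLevelCensusIndexV1 (KIdx kGeo) open B9Eq316AveragingTransposeZd (alphaQ)
open B9Eq3115KnitLetterYNumerics (knitWindow_inhabited_le)

variable (d ℓ : ℕ)

/-! ## §1 Casts and monomial slack -/

/-- `5 ≤ d + 5`. [folklore] -/
private theorem hA5 : (5 : ℝ) ≤ (d : ℝ) + 5 := by have : (0 : ℝ) ≤ d := Nat.cast_nonneg d; linarith
/-- `1 ≤ ℓ + 1`. [folklore] -/
private theorem hL1 : (1 : ℝ) ≤ (ℓ : ℝ) + 1 := by have : (0 : ℝ) ≤ ℓ := Nat.cast_nonneg ℓ; linarith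
/-- `(ℓ+1)^a ≤ (ℓ+1)^{d+3}` for `a ≤ d + 3`. [folklore] -/
private theorem hPow {a : ℕ} (ha : a ≤ d + 3) : ((ℓ : ℝ) + 1) ^ a ≤ ((ℓ : ℝ) + 1) ^ (d + 3) := pow_le_pow_right₀ (hL1 ℓ) ha
/-- `ℓ+1 ≤ (ℓ+1)^{d+3}`. [folklore] -/
private theorem hLpow : ((ℓ : ℝ) + 1) ≤ ((ℓ : ℝ) + 1) ^ (d + 3) := by
  calc ((ℓ : ℝ) + 1) = ((ℓ : ℝ) + 1) ^ 1 := (pow_one _).symm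
    _ ≤ ((ℓ : ℝ) + 1) ^ (d + 3) := pow_le_pow_right₀ (hL1 ℓ) (by omega)
/-- `(ℓ+1)^a ≤ (ℓ+1)^{d+2}` for `a ≤ d + 2`. [folklore] -/
private theorem hPow' {a : ℕ} (ha : a ≤ d + 2) : ((ℓ : ℝ) + 1) ^ a ≤ ((ℓ : ℝ) + 1) ^ (d + 2) := pow_le_pow_right₀ (hL1 ℓ) ha
/-- the casts of the window: `((d+1:ℕ):ℝ) + 1 = d + 2`, `((d+1:ℕ):ℝ) + 4 = d + 5`, `((d+1:ℕ):ℝ) = d + 1`, `((ℓ+1:ℕ):ℝ) = ℓ + 1`. [folklore] -/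
private theorem casts : (((d + 1 : ℕ) : ℝ) + 1) = (d : ℝ) + 2 ∧ (((d + 1 : ℕ) : ℝ) + 4) = (d : ℝ) + 5 ∧ ((d + 1 : ℕ) : ℝ) = (d : ℝ) + 1 ∧
    ((ℓ + 1 : ℕ) : ℝ) = (ℓ : ℝ) + 1 := by
  refine ⟨?_, ?_, ?_, ?_⟩ <;> push_cast <;> ring

/-- `e^x ≤ 1 + 2x` for `0 ≤ x ≤ 1`. [folklore] -/
private theorem exp_le_one_add_two_mul {x : ℝ} (hx0 : 0 ≤ x) (hx1 : x ≤ 1) : Real.exp x ≤ 1 + 2 * x := by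
  have habs : |x| ≤ 1 := by rw [abs_of_nonneg hx0]; exact hx1
  have h := Real.abs_exp_sub_one_le habs
  rw [abs_of_nonneg hx0] at h
  linarith [le_abs_self (Real.exp x - 1)]

/-! ## §2 The window inequalities at the witnesses `α₀′ := alpha0W d ℓ`, `ϱ′ = ϱ = α_K := bbW d ℓ` -/

/-- (hα8) `8α₀′ ≤ c₂′(d+1, ℓ+1)` (the Prop-7 form of the `α₀`-smallness, twice g34's `hα4_b7W`). [cite: Balaban1985Averaging, Proposition 7 p.43 («α₀ sufficiently small»), (51) p.26] -/
theorem hα8_knitV {α : ℝ} (hα : α ≤ alpha0W d ℓ) : 8 * α ≤ c2' (d + 1) (ℓ + 1) := by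
  have hA := hA5 d; have hd0 : (0 : ℝ) ≤ d := Nat.cast_nonneg d; have hl := hL1 ℓ
  have hP : ((ℓ : ℝ) + 1) ^ 2 ≤ ((ℓ : ℝ) + 1) ^ (d + 2) := hPow' d ℓ (by omega)
  have h : alpha0W d ℓ ≤ 1 / (8 * (512 * (((d : ℝ) + 2) * ((d : ℝ) + 5)) * ((ℓ : ℝ) + 1) ^ 2)) := by
    refine alpha0W_le_one_div d ℓ (by positivity) ?_
    calc 8 * (512 * (((d : ℝ) + 2) * ((d : ℝ) + 5)) * ((ℓ : ℝ) + 1) ^ 2) ≤ 8 * (512 * ((((d : ℝ) + 5)) * ((d : ℝ) + 5)) * ((ℓ : ℝ) + 1) ^ (d + 2)) := by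
          gcongr; linarith
      _ = 4096 * 1 * 1 * ((d : ℝ) + 5) ^ 2 * ((ℓ : ℝ) + 1) ^ (d + 2) := by ring
      _ ≤ 2 ^ 30 * ((d : ℝ) + 5) * ((d : ℝ) + 5) * ((d : ℝ) + 5) ^ 2 * ((ℓ : ℝ) + 1) ^ (d + 2) := by gcongr <;> linarith
      _ = 2 ^ 30 * ((d : ℝ) + 5) ^ 4 * ((ℓ : ℝ) + 1) ^ (d + 2) := by ring
  rw [c2'_succ]
  calc 8 * α ≤ 8 * alpha0W d ℓ := by linarith
    _ ≤ 8 * (1 / (8 * (512 * (((d : ℝ) + 2) * ((d : ℝ) + 5)) * ((ℓ : ℝ) + 1) ^ 2))) := by gcongr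
    _ = 1 / (512 * (((d : ℝ) + 2) * ((d : ℝ) + 5)) * ((ℓ : ℝ) + 1) ^ 2) := by field_simp

/-- (hsmall′) `e^{4·800(d+2)²(d+5)α₀′}(1 + 8·131072(d+2)²ϱ′) ≤ 2` for `α₀′ ≤ alpha0W`, `ϱ′ := bbW` (g34's `hsmall_b7W` by monotonicity).
[cite: Balaban1985Averaging, Proposition 7 p.43, (131) p.38] -/
theorem hsmall'_knitV {α : ℝ} (hα : α ≤ alpha0W d ℓ) :
    Real.exp (4 * (800 * (((d + 1 : ℕ) : ℝ) + 1) ^ 2 * (((d + 1 : ℕ) : ℝ) + 4)) * α) * (1 + 8 * (131072 * (((d + 1 : ℕ) : ℝ) + 1) ^ 2) * bbW d ℓ) ≤ 2 := by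
  have hb0 := (bbW_pos d ℓ).le
  have hX0 : 0 ≤ 4 * (800 * (((d + 1 : ℕ) : ℝ) + 1) ^ 2 * (((d + 1 : ℕ) : ℝ) + 4)) := by positivity
  have hY0 : 0 ≤ 1 + 8 * (131072 * (((d + 1 : ℕ) : ℝ) + 1) ^ 2) * bbW d ℓ := by positivity
  calc Real.exp (4 * (800 * (((d + 1 : ℕ) : ℝ) + 1) ^ 2 * (((d + 1 : ℕ) : ℝ) + 4)) * α) * (1 + 8 * (131072 * (((d + 1 : ℕ) : ℝ) + 1) ^ 2) * bbW d ℓ)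
      ≤ Real.exp (4 * (800 * (((d + 1 : ℕ) : ℝ) + 1) ^ 2 * (((d + 1 : ℕ) : ℝ) + 4)) * alpha0W d ℓ) * (1 + 8 * (131072 * (((d + 1 : ℕ) : ℝ) + 1) ^ 2) * bbW d ℓ) := by
        gcongr
    _ ≤ 2 := hsmall_b7W d ℓ

/-- (hc₃′) `2ϱ′ ≤ c₃(d+1, ℓ+1)` (g34's `hc3_b7W`: `4b < c₃`). [cite: Balaban1985Averaging, Proposition 7 p.43, (122) p.36] -/
theorem hc₃'_knitV : 2 * bbW d ℓ ≤ c3 (d + 1) (ℓ + 1) := by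
  have h := hc3_b7W d ℓ; have := bbW_pos d ℓ; linarith

/-- (hc₃) `2ϱ ≤ c₃(d+1, ℓ+1)∕4` with `ϱ := bbW∕1`… here directly `2·bbW ≤ c₃∕4` (`bbW ≤ 1∕(8·128(d+2)(ℓ+1))`). [cite: Balaban1985Averaging, Proposition 7 p.43, (122) p.36] -/
theorem hc₃_knitV : 2 * bbW d ℓ ≤ c3 (d + 1) (ℓ + 1) / 4 := by
  have hA := hA5 d; have hd0 : (0 : ℝ) ≤ d := Nat.cast_nonneg d; have hl := hL1 ℓ
  rw [c3_succ]
  have hLQ : ((ℓ : ℝ) + 1) ≤ ((ℓ : ℝ) + 1) ^ (d + 3) := hLpow d ℓ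
  have h : bbW d ℓ ≤ 1 / (8 * (128 * ((d : ℝ) + 2) * ((ℓ : ℝ) + 1))) := by
    refine bbW_le_one_div d ℓ (by positivity) ?_
    calc 8 * (128 * ((d : ℝ) + 2) * ((ℓ : ℝ) + 1)) ≤ 8 * (128 * ((d : ℝ) + 5) * ((ℓ : ℝ) + 1) ^ (d + 3)) := by gcongr; linarith
      _ = 1024 * 1 * (((d : ℝ) + 5) * 1) * ((ℓ : ℝ) + 1) ^ (d + 3) := by ring
      _ ≤ 2 ^ 30 * 131072 * (((d : ℝ) + 5) * ((d : ℝ) + 5) ^ 2) * ((ℓ : ℝ) + 1) ^ (d + 3) := by gcongr <;> nlinarith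
      _ = 2 ^ 30 * 131072 * ((d : ℝ) + 5) ^ 3 * ((ℓ : ℝ) + 1) ^ (d + 3) := by ring
  calc 2 * bbW d ℓ ≤ 2 * (1 / (8 * (128 * ((d : ℝ) + 2) * ((ℓ : ℝ) + 1)))) := by gcongr
    _ = 1 / (128 * ((d : ℝ) + 2) * ((ℓ : ℝ) + 1)) / 4 := by field_simp; ring

/-- (hϱ′1) `409600(d+2)²·ϱ′ ≤ 1`. [cite: Balaban1985Averaging, Proposition 7 p.43 («α₁ sufficiently small»), Proposition 6 (164) p.43] -/
theorem hϱ'1_knitV : 409600 * (((d + 1 : ℕ) : ℝ) + 1) ^ 2 * bbW d ℓ ≤ 1 := by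
  obtain ⟨e2, -, -, -⟩ := casts d ℓ
  have hA := hA5 d; have hd0 : (0 : ℝ) ≤ d := Nat.cast_nonneg d; have hQ := hPow d ℓ (le_refl (d + 3))
  have hQ1 : (1 : ℝ) ≤ ((ℓ : ℝ) + 1) ^ (d + 3) := one_le_pow₀ (hL1 ℓ)
  rw [e2]
  have h : bbW d ℓ ≤ 1 / (409600 * ((d : ℝ) + 2) ^ 2) := by
    refine bbW_le_one_div d ℓ (by positivity) ?_
    calc 409600 * ((d : ℝ) + 2) ^ 2 ≤ 409600 * ((d : ℝ) + 5) ^ 2 := by gcongr; linarith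
      _ = 409600 * 1 * (((d : ℝ) + 5) ^ 2 * 1) * 1 := by ring
      _ ≤ 2 ^ 30 * 131072 * (((d : ℝ) + 5) ^ 2 * ((d : ℝ) + 5)) * ((ℓ : ℝ) + 1) ^ (d + 3) := by gcongr <;> linarith
      _ = 2 ^ 30 * 131072 * ((d : ℝ) + 5) ^ 3 * ((ℓ : ℝ) + 1) ^ (d + 3) := by ring
  calc 409600 * ((d : ℝ) + 2) ^ 2 * bbW d ℓ ≤ 409600 * ((d : ℝ) + 2) ^ 2 * (1 / (409600 * ((d : ℝ) + 2) ^ 2)) := by gcongr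
    _ = 1 := by field_simp

/-- the one-step numerics `ε(ϱ′)`, `τ(α₀′, ϱ′)` at `k = j = 0`, unfolded and cast. [cite: Balaban1985Averaging, (139) p.39, (144)–(145) p.40, bookkeeping] -/
private theorem eps_tau_eq (b' α : ℝ) :
    epsCplx (d + 1) (ℓ + 1) b' 0 = 4800 * ((ℓ : ℝ) + 1) * ((d : ℝ) + 2) ^ 2 * b' ∧
      tauCplx (d + 1) (ℓ + 1) α 0 b' 0 =
        (4480 * ((d : ℝ) + 2) * ((d : ℝ) + 5) * ((ℓ : ℝ) + 1) ^ 2 * α + 224000 * ((ℓ : ℝ) + 1) * ((d : ℝ) + 2) ^ 2 * b') *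
          ((ℓ : ℝ) + 1) ^ (d + 1) * (((ℓ : ℝ) + 1))⁻¹ := by
  have hc : ((2 * ((d + 1) * (ℓ + 1)) + (ℓ + 1) + (ℓ + 1) : ℕ) : ℝ) = 2 * ((ℓ : ℝ) + 1) * ((d : ℝ) + 2) := by push_cast; ring
  unfold epsCplx tauCplx
  rw [hc]
  constructor
  · push_cast; ring
  · push_cast; ring

/-- (hE) `ε(ϱ′) ≤ 1∕16`. [cite: Balaban1985Averaging, (145) p.40, Proposition 7 p.43] -/
theorem hE_knitV : epsCplx (d + 1) (ℓ + 1) (bbW d ℓ) 0 ≤ 1 / 16 := by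
  obtain ⟨he, -⟩ := eps_tau_eq d ℓ (bbW d ℓ) 0
  have hA := hA5 d; have hd0 : (0 : ℝ) ≤ d := Nat.cast_nonneg d; have hl := hL1 ℓ
  have hLQ : ((ℓ : ℝ) + 1) ≤ ((ℓ : ℝ) + 1) ^ (d + 3) := hLpow d ℓ
  rw [he]
  have h : bbW d ℓ ≤ 1 / (16 * (4800 * ((ℓ : ℝ) + 1) * ((d : ℝ) + 2) ^ 2)) := by
    refine bbW_le_one_div d ℓ (by positivity) ?_
    calc 16 * (4800 * ((ℓ : ℝ) + 1) * ((d : ℝ) + 2) ^ 2) ≤ 16 * (4800 * ((ℓ : ℝ) + 1) ^ (d + 3) * ((d : ℝ) + 5) ^ 2) := by gcongr; linarith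
      _ = 76800 * 1 * (((d : ℝ) + 5) ^ 2 * 1) * ((ℓ : ℝ) + 1) ^ (d + 3) := by ring
      _ ≤ 2 ^ 30 * 131072 * (((d : ℝ) + 5) ^ 2 * ((d : ℝ) + 5)) * ((ℓ : ℝ) + 1) ^ (d + 3) := by gcongr <;> linarith
      _ = 2 ^ 30 * 131072 * ((d : ℝ) + 5) ^ 3 * ((ℓ : ℝ) + 1) ^ (d + 3) := by ring
  calc 4800 * ((ℓ : ℝ) + 1) * ((d : ℝ) + 2) ^ 2 * bbW d ℓ ≤ 4800 * ((ℓ : ℝ) + 1) * ((d : ℝ) + 2) ^ 2 * (1 / (16 * (4800 * ((ℓ : ℝ) + 1) * ((d : ℝ) + 2) ^ 2))) := by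
        gcongr
    _ = 1 / 16 := by field_simp

/-- (hdX) `(d+1)·(ε(ϱ′) + τ(α₀′, ϱ′)) ≤ 1∕16`. [cite: Balaban1985Averaging, (145) p.40, Proposition 7 p.43] -/
theorem hdX_knitV {α : ℝ} (hα0 : 0 ≤ α) (hα : α ≤ alpha0W d ℓ) :
    ((d + 1 : ℕ) : ℝ) * (epsCplx (d + 1) (ℓ + 1) (bbW d ℓ) 0 + tauCplx (d + 1) (ℓ + 1) α 0 (bbW d ℓ) 0) ≤ 1 / 16 := by
  obtain ⟨he, ht⟩ := eps_tau_eq d ℓ (bbW d ℓ) α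
  obtain ⟨-, -, e1, -⟩ := casts d ℓ
  have hA := hA5 d; have hd0 : (0 : ℝ) ≤ d := Nat.cast_nonneg d; have hl := hL1 ℓ
  have hb0 := (bbW_pos d ℓ).le
  rw [he, ht, e1]
  -- drop the harmless factor `(ℓ+1)⁻¹ ≤ 1`
  have hinv : (((ℓ : ℝ) + 1))⁻¹ ≤ 1 := inv_le_one_of_one_le₀ hl
  have hP1 : ((ℓ : ℝ) + 1) * ((ℓ : ℝ) + 1) ^ (d + 1) ≤ ((ℓ : ℝ) + 1) ^ (d + 3) := by
    rw [← pow_succ']; exact hPow d ℓ (by omega)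
  have hP2 : ((ℓ : ℝ) + 1) ^ 2 * ((ℓ : ℝ) + 1) ^ (d + 1) ≤ ((ℓ : ℝ) + 1) ^ (d + 2) * ((ℓ : ℝ) + 1) := by
    rw [← pow_add, ← pow_succ]; exact pow_le_pow_right₀ hl (by omega)
  -- the three pieces: ε-term ≤ 1∕64·(d+1)⁻¹·…; we bound each by an absolute `1∕(64(d+1))`
  have hd1 : (0 : ℝ) < (d : ℝ) + 1 := by linarith
  -- (a) the ε-term
  have hεb : ((d : ℝ) + 1) * (4800 * ((ℓ : ℝ) + 1) * ((d : ℝ) + 2) ^ 2 * bbW d ℓ) ≤ 1 / 64 := by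
    have h : bbW d ℓ ≤ 1 / (64 * (((d : ℝ) + 1) * (4800 * ((ℓ : ℝ) + 1) * ((d : ℝ) + 2) ^ 2))) := by
      refine bbW_le_one_div d ℓ (by positivity) ?_
      calc 64 * (((d : ℝ) + 1) * (4800 * ((ℓ : ℝ) + 1) * ((d : ℝ) + 2) ^ 2))
          ≤ 64 * (((d : ℝ) + 5) * (4800 * ((ℓ : ℝ) + 1) ^ (d + 3) * ((d : ℝ) + 5) ^ 2)) := by
            gcongr
            · linarith
            · exact hLpow d ℓ
            · linarith
        _ = 307200 * 1 * ((d : ℝ) + 5) ^ 3 * ((ℓ : ℝ) + 1) ^ (d + 3) := by ring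
        _ ≤ 2 ^ 30 * 131072 * ((d : ℝ) + 5) ^ 3 * ((ℓ : ℝ) + 1) ^ (d + 3) := by gcongr <;> norm_num
    calc ((d : ℝ) + 1) * (4800 * ((ℓ : ℝ) + 1) * ((d : ℝ) + 2) ^ 2 * bbW d ℓ)
        = (((d : ℝ) + 1) * (4800 * ((ℓ : ℝ) + 1) * ((d : ℝ) + 2) ^ 2)) * bbW d ℓ := by ring
      _ ≤ (((d : ℝ) + 1) * (4800 * ((ℓ : ℝ) + 1) * ((d : ℝ) + 2) ^ 2)) * (1 / (64 * (((d : ℝ) + 1) * (4800 * ((ℓ : ℝ) + 1) * ((d : ℝ) + 2) ^ 2)))) := by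
          gcongr
      _ = 1 / 64 := by field_simp
  -- (b) the α-term of τ (with `(ℓ+1)⁻¹` dropped)
  have hαb : ((d : ℝ) + 1) * (4480 * ((d : ℝ) + 2) * ((d : ℝ) + 5) * ((ℓ : ℝ) + 1) ^ 2 * α) * ((ℓ : ℝ) + 1) ^ (d + 1) * (((ℓ : ℝ) + 1))⁻¹ ≤ 1 / 64 := by
    have h : α ≤ 1 / (64 * (((d : ℝ) + 1) * (4480 * ((d : ℝ) + 2) * ((d : ℝ) + 5)) * ((ℓ : ℝ) + 1) ^ (d + 2))) := by
      refine hα.trans (alpha0W_le_one_div d ℓ (by positivity) ?_)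
      calc 64 * (((d : ℝ) + 1) * (4480 * ((d : ℝ) + 2) * ((d : ℝ) + 5)) * ((ℓ : ℝ) + 1) ^ (d + 2))
          ≤ 64 * (((d : ℝ) + 5) * (4480 * ((d : ℝ) + 5) * ((d : ℝ) + 5)) * ((ℓ : ℝ) + 1) ^ (d + 2)) := by gcongr <;> linarith
        _ = 286720 * 1 * ((d : ℝ) + 5) ^ 3 * ((ℓ : ℝ) + 1) ^ (d + 2) := by ring
        _ ≤ 2 ^ 30 * ((d : ℝ) + 5) * ((d : ℝ) + 5) ^ 3 * ((ℓ : ℝ) + 1) ^ (d + 2) := by gcongr <;> linarith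
        _ = 2 ^ 30 * ((d : ℝ) + 5) ^ 4 * ((ℓ : ℝ) + 1) ^ (d + 2) := by ring
    calc ((d : ℝ) + 1) * (4480 * ((d : ℝ) + 2) * ((d : ℝ) + 5) * ((ℓ : ℝ) + 1) ^ 2 * α) * ((ℓ : ℝ) + 1) ^ (d + 1) * (((ℓ : ℝ) + 1))⁻¹
        = (((d : ℝ) + 1) * (4480 * ((d : ℝ) + 2) * ((d : ℝ) + 5))) * (((ℓ : ℝ) + 1) ^ 2 * ((ℓ : ℝ) + 1) ^ (d + 1) * (((ℓ : ℝ) + 1))⁻¹) * α := by ring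
      _ ≤ (((d : ℝ) + 1) * (4480 * ((d : ℝ) + 2) * ((d : ℝ) + 5))) * ((ℓ : ℝ) + 1) ^ (d + 2) * α := by
          gcongr
          calc ((ℓ : ℝ) + 1) ^ 2 * ((ℓ : ℝ) + 1) ^ (d + 1) * (((ℓ : ℝ) + 1))⁻¹
              ≤ ((ℓ : ℝ) + 1) ^ (d + 2) * ((ℓ : ℝ) + 1) * (((ℓ : ℝ) + 1))⁻¹ := by gcongr
            _ = ((ℓ : ℝ) + 1) ^ (d + 2) := by field_simp
      _ ≤ (((d : ℝ) + 1) * (4480 * ((d : ℝ) + 2) * ((d : ℝ) + 5))) * ((ℓ : ℝ) + 1) ^ (d + 2) *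
            (1 / (64 * (((d : ℝ) + 1) * (4480 * ((d : ℝ) + 2) * ((d : ℝ) + 5)) * ((ℓ : ℝ) + 1) ^ (d + 2)))) := by gcongr
      _ = 1 / 64 := by field_simp
  -- (c) the ϱ′-term of τ
  have hϱb : ((d : ℝ) + 1) * (224000 * ((ℓ : ℝ) + 1) * ((d : ℝ) + 2) ^ 2 * bbW d ℓ) * ((ℓ : ℝ) + 1) ^ (d + 1) * (((ℓ : ℝ) + 1))⁻¹ ≤ 1 / 64 := by
    have h : bbW d ℓ ≤ 1 / (64 * (((d : ℝ) + 1) * (224000 * ((d : ℝ) + 2) ^ 2) * ((ℓ : ℝ) + 1) ^ (d + 1))) := by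
      refine bbW_le_one_div d ℓ (by positivity) ?_
      calc 64 * (((d : ℝ) + 1) * (224000 * ((d : ℝ) + 2) ^ 2) * ((ℓ : ℝ) + 1) ^ (d + 1))
          ≤ 64 * (((d : ℝ) + 5) * (224000 * ((d : ℝ) + 5) ^ 2) * ((ℓ : ℝ) + 1) ^ (d + 3)) := by
            have hP3 : ((ℓ : ℝ) + 1) ^ (d + 1) ≤ ((ℓ : ℝ) + 1) ^ (d + 3) := hPow d ℓ (by omega)
            gcongr <;> linarith
        _ = 14336000 * 1 * ((d : ℝ) + 5) ^ 3 * ((ℓ : ℝ) + 1) ^ (d + 3) := by ring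
        _ ≤ 2 ^ 30 * 131072 * ((d : ℝ) + 5) ^ 3 * ((ℓ : ℝ) + 1) ^ (d + 3) := by gcongr <;> norm_num
    calc ((d : ℝ) + 1) * (224000 * ((ℓ : ℝ) + 1) * ((d : ℝ) + 2) ^ 2 * bbW d ℓ) * ((ℓ : ℝ) + 1) ^ (d + 1) * (((ℓ : ℝ) + 1))⁻¹
        = (((d : ℝ) + 1) * (224000 * ((d : ℝ) + 2) ^ 2) * ((ℓ : ℝ) + 1) ^ (d + 1)) * (((ℓ : ℝ) + 1) * (((ℓ : ℝ) + 1))⁻¹) * bbW d ℓ := by ring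
      _ = (((d : ℝ) + 1) * (224000 * ((d : ℝ) + 2) ^ 2) * ((ℓ : ℝ) + 1) ^ (d + 1)) * bbW d ℓ := by
          rw [mul_inv_cancel₀ (by positivity : ((ℓ : ℝ) + 1) ≠ 0), mul_one]
      _ ≤ (((d : ℝ) + 1) * (224000 * ((d : ℝ) + 2) ^ 2) * ((ℓ : ℝ) + 1) ^ (d + 1)) *
            (1 / (64 * (((d : ℝ) + 1) * (224000 * ((d : ℝ) + 2) ^ 2) * ((ℓ : ℝ) + 1) ^ (d + 1)))) := by gcongr
      _ = 1 / 64 := by field_simp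
  have hsum : ((d : ℝ) + 1) * (4800 * ((ℓ : ℝ) + 1) * ((d : ℝ) + 2) ^ 2 * bbW d ℓ +
      (4480 * ((d : ℝ) + 2) * ((d : ℝ) + 5) * ((ℓ : ℝ) + 1) ^ 2 * α + 224000 * ((ℓ : ℝ) + 1) * ((d : ℝ) + 2) ^ 2 * bbW d ℓ) *
        ((ℓ : ℝ) + 1) ^ (d + 1) * (((ℓ : ℝ) + 1))⁻¹) =
      ((d : ℝ) + 1) * (4800 * ((ℓ : ℝ) + 1) * ((d : ℝ) + 2) ^ 2 * bbW d ℓ) +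
        ((d : ℝ) + 1) * (4480 * ((d : ℝ) + 2) * ((d : ℝ) + 5) * ((ℓ : ℝ) + 1) ^ 2 * α) * ((ℓ : ℝ) + 1) ^ (d + 1) * (((ℓ : ℝ) + 1))⁻¹ +
        ((d : ℝ) + 1) * (224000 * ((ℓ : ℝ) + 1) * ((d : ℝ) + 2) ^ 2 * bbW d ℓ) * ((ℓ : ℝ) + 1) ^ (d + 1) * (((ℓ : ℝ) + 1))⁻¹ := by ring
  rw [hsum]
  linarith

/-- (hsmall) `e^{4480(d+2)²(d+5)α₀′ + 240000(d+2)³ϱ′}·(1 + 8·2097152(d+2)²·ϱ) ≤ 2` at `ϱ := bbW`. [cite: Balaban1985Averaging, Proposition 7 p.43, (131) p.38] -/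
theorem hsmall_knitV {α : ℝ} (hα0 : 0 ≤ α) (hα : α ≤ alpha0W d ℓ) :
    Real.exp (4480 * (((d + 1 : ℕ) : ℝ) + 1) ^ 2 * (((d + 1 : ℕ) : ℝ) + 4) * α + 240000 * (((d + 1 : ℕ) : ℝ) + 1) ^ 3 * bbW d ℓ) *
        (1 + 8 * (2097152 * (((d + 1 : ℕ) : ℝ) + 1) ^ 2) * bbW d ℓ) ≤ 2 := by
  obtain ⟨e2, e5, -, -⟩ := casts d ℓ
  have hA := hA5 d; have hd0 : (0 : ℝ) ≤ d := Nat.cast_nonneg d; have hl := hL1 ℓ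
  have hP := (one_le_pow₀ hl : (1 : ℝ) ≤ ((ℓ : ℝ) + 1) ^ (d + 2)); have hQ := (one_le_pow₀ hl : (1 : ℝ) ≤ ((ℓ : ℝ) + 1) ^ (d + 3))
  rw [e2, e5]
  set x₁ : ℝ := 4480 * ((d : ℝ) + 2) ^ 2 * ((d : ℝ) + 5) * α with hx₁
  set x₂ : ℝ := 240000 * ((d : ℝ) + 2) ^ 3 * bbW d ℓ with hx₂
  set y : ℝ := 8 * (2097152 * ((d : ℝ) + 2) ^ 2) * bbW d ℓ with hy
  have hb0 := (bbW_pos d ℓ).le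
  have hx₁0 : 0 ≤ x₁ := by rw [hx₁]; positivity
  have hx₂0 : 0 ≤ x₂ := by rw [hx₂]; positivity
  have hy0 : 0 ≤ y := by rw [hy]; positivity
  have hx₁1 : x₁ ≤ 1 / 8 := by
    have h : α ≤ 1 / (8 * (4480 * ((d : ℝ) + 2) ^ 2 * ((d : ℝ) + 5))) := by
      refine hα.trans (alpha0W_le_one_div d ℓ (by positivity) ?_)
      calc 8 * (4480 * ((d : ℝ) + 2) ^ 2 * ((d : ℝ) + 5)) ≤ 8 * (4480 * ((d : ℝ) + 5) ^ 2 * ((d : ℝ) + 5)) := by gcongr; linarith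
        _ = 35840 * 1 * ((d : ℝ) + 5) ^ 3 * 1 := by ring
        _ ≤ 2 ^ 30 * ((d : ℝ) + 5) * ((d : ℝ) + 5) ^ 3 * ((ℓ : ℝ) + 1) ^ (d + 2) := by gcongr <;> linarith
        _ = 2 ^ 30 * ((d : ℝ) + 5) ^ 4 * ((ℓ : ℝ) + 1) ^ (d + 2) := by ring
    calc x₁ = (4480 * ((d : ℝ) + 2) ^ 2 * ((d : ℝ) + 5)) * α := by rw [hx₁]
      _ ≤ (4480 * ((d : ℝ) + 2) ^ 2 * ((d : ℝ) + 5)) * (1 / (8 * (4480 * ((d : ℝ) + 2) ^ 2 * ((d : ℝ) + 5)))) := by gcongr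
      _ = 1 / 8 := by field_simp
  have hx₂1 : x₂ ≤ 1 / 8 := by
    have h : bbW d ℓ ≤ 1 / (8 * (240000 * ((d : ℝ) + 2) ^ 3)) := by
      refine bbW_le_one_div d ℓ (by positivity) ?_
      calc 8 * (240000 * ((d : ℝ) + 2) ^ 3) ≤ 8 * (240000 * ((d : ℝ) + 5) ^ 3) := by gcongr; linarith
        _ = 1920000 * 1 * ((d : ℝ) + 5) ^ 3 * 1 := by ring
        _ ≤ 2 ^ 30 * 131072 * ((d : ℝ) + 5) ^ 3 * ((ℓ : ℝ) + 1) ^ (d + 3) := by gcongr <;> norm_num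
    calc x₂ = (240000 * ((d : ℝ) + 2) ^ 3) * bbW d ℓ := by rw [hx₂]
      _ ≤ (240000 * ((d : ℝ) + 2) ^ 3) * (1 / (8 * (240000 * ((d : ℝ) + 2) ^ 3))) := by gcongr
      _ = 1 / 8 := by field_simp
  have hy1 : y ≤ 1 / 4 := by
    have h : bbW d ℓ ≤ 1 / (4 * (8 * (2097152 * ((d : ℝ) + 2) ^ 2))) := by
      refine bbW_le_one_div d ℓ (by positivity) ?_
      calc 4 * (8 * (2097152 * ((d : ℝ) + 2) ^ 2)) ≤ 4 * (8 * (2097152 * ((d : ℝ) + 5) ^ 2)) := by gcongr; linarith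
        _ = 67108864 * (((d : ℝ) + 5) ^ 2 * 1) * 1 := by ring
        _ ≤ 2 ^ 30 * 131072 * (((d : ℝ) + 5) ^ 2 * ((d : ℝ) + 5)) * ((ℓ : ℝ) + 1) ^ (d + 3) := by gcongr <;> linarith
        _ = 2 ^ 30 * 131072 * ((d : ℝ) + 5) ^ 3 * ((ℓ : ℝ) + 1) ^ (d + 3) := by ring
    calc y = (8 * (2097152 * ((d : ℝ) + 2) ^ 2)) * bbW d ℓ := by rw [hy]
      _ ≤ (8 * (2097152 * ((d : ℝ) + 2) ^ 2)) * (1 / (4 * (8 * (2097152 * ((d : ℝ) + 2) ^ 2)))) := by gcongr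
      _ = 1 / 4 := by field_simp
  have hexp : Real.exp (x₁ + x₂) ≤ 1 + 2 * (x₁ + x₂) := exp_le_one_add_two_mul (by positivity) (by linarith)
  calc Real.exp (x₁ + x₂) * (1 + y) ≤ (1 + 2 * (x₁ + x₂)) * (1 + y) := by gcongr
    _ ≤ (1 + 2 * (1 / 8 + 1 / 8)) * (1 + 1 / 4) := by gcongr
    _ ≤ 2 := by norm_num

/-- (hsm) `4096(d+1)·α_K ≤ 1` at `α_K := bbW`. [cite: Balaban1985BackgroundPropagators, (3.58) p.402 («α₁ sufficiently small»); Balaban1985Averaging, Proposition 7 p.43] -/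
theorem hsm_knitV : 4096 * ((d + 1 : ℕ) : ℝ) * bbW d ℓ ≤ 1 := by
  obtain ⟨-, -, e1, -⟩ := casts d ℓ
  have hA := hA5 d; have hd0 : (0 : ℝ) ≤ d := Nat.cast_nonneg d
  have hQ := (one_le_pow₀ (hL1 ℓ) : (1 : ℝ) ≤ ((ℓ : ℝ) + 1) ^ (d + 3))
  rw [e1]
  have h : bbW d ℓ ≤ 1 / (4096 * ((d : ℝ) + 1)) := by
    refine bbW_le_one_div d ℓ (by positivity) ?_
    calc 4096 * ((d : ℝ) + 1) ≤ 4096 * ((d : ℝ) + 5) := by linarith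
      _ = 4096 * 1 * (1 * ((d : ℝ) + 5)) * 1 := by ring
      _ ≤ 2 ^ 30 * 131072 * (((d : ℝ) + 5) ^ 2 * ((d : ℝ) + 5)) * ((ℓ : ℝ) + 1) ^ (d + 3) := by
          gcongr <;> nlinarith
      _ = 2 ^ 30 * 131072 * ((d : ℝ) + 5) ^ 3 * ((ℓ : ℝ) + 1) ^ (d + 3) := by ring
  calc 4096 * ((d : ℝ) + 1) * bbW d ℓ ≤ 4096 * ((d : ℝ) + 1) * (1 / (4096 * ((d : ℝ) + 1))) := by gcongr
    _ = 1 := by field_simp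

/-! ## §3 ★★★ The knit variation window is inhabited (jointly with the knit-letter window of `B9Eq3115KnitLetterYNumerics`) -/

/-- ★★★ **THE x-FREE WINDOW OF THE KNIT VARIATION LAWS IS INHABITED AT EVERY `(d+1, ℓ+1)`, JOINTLY WITH THE KNIT-LETTER WINDOW**: there are `α₀′ ∈ (0, amax]` (any
prescribed `amax > 0`), `ϱ′ > 0` and a plaquette threshold `a₁ > 0` such that (i) the knit-letter numerics of `B9Eq3115KnitLetterYNumerics.knitWindow_inhabited_le` hold —
`α₀′ ≤ α_Q`, `C₀α₀′ ≤ ⅓`, `2α₀′ ≤ c₂′`, `4α₀′ ≤ c₂′`, `e^{3200(d+2)²(d+5)α₀′} < 2`, `K(d+1,L)α₀′ < 1`; (ii) the Prop-7 ∕ variation numerics of `B9Eq380QknitVariationY` ∕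
`…N06SectBQVarLawsKnit.hQ80_knit ∕ hQL280_knit` hold at `(α₀′, ϱ′, ϱ := ϱ′)` — `8α₀′ ≤ c₂′`, `hsmall′`, `hc₃′ : 2ϱ′ ≤ c₃`, `hϱ′1`, `hE`, `hdX`, `hsmall`, `hc₃ : 2ϱ′ ≤ c₃∕4`;
(iii) the (3.58) window of `B9Eq358KnitTransporterVariationY.parVar337Y_parKnitY` at `α_K := ϱ′` — `4096(d+1)ϱ′ ≤ 1` (with `hsmall′`, `hc₃′` above); (iv) the plaquette
threshold for all `0 ≤ a ≤ a₁` in both spellings, unfolded `2(10La)(1+10La)e^{40La}·L⁴ < α₀′` and folded `Kpl i a * (kGeo i).L ^ 4 < α₀′` for every k-level index `i` over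
`(d, ℓ)`.  Witnesses: `α₀′ := min (min amax alpha0W) α_KW(d,ℓ)` (≤ `alpha0W d ℓ`), `ϱ′ := bbW d ℓ`, `a₁ := α₀′∕(128L⁵)`.
[cite: Balaban1985Averaging, Proposition 7 p.43, Proposition 5 (145) p.40, (147) p.40; Balaban1985BackgroundPropagators, (3.81) p.406, (3.58) p.402, (3.35) p.396] -/
theorem knitVarWindow_inhabited_le {amax : ℝ} (hamax : 0 < amax) :
    ∃ α₀' ϱ' a₁ : ℝ, 0 < α₀' ∧ α₀' ≤ amax ∧ 0 < ϱ' ∧ 0 < a₁ ∧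
      -- (i) the knit-letter window
      α₀' ≤ alphaQ (d + 1) (ℓ + 1) ∧ C0 (d + 1) * α₀' ≤ 1 / 3 ∧ 2 * α₀' ≤ c2' (d + 1) (ℓ + 1) ∧ 4 * α₀' ≤ c2' (d + 1) (ℓ + 1) ∧
      Real.exp (4 * (800 * (((d + 1 : ℕ) : ℝ) + 1) ^ 2 * (((d + 1 : ℕ) : ℝ) + 4)) * α₀') < 2 ∧
      kCol (d + 1) (ℓ + 1) * α₀' < 1 ∧
      -- (ii) the Prop-7 ∕ variation window at `(α₀′, ϱ′, ϱ := ϱ′)`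
      8 * α₀' ≤ c2' (d + 1) (ℓ + 1) ∧
      Real.exp (4 * (800 * (((d + 1 : ℕ) : ℝ) + 1) ^ 2 * (((d + 1 : ℕ) : ℝ) + 4)) * α₀') * (1 + 8 * (131072 * (((d + 1 : ℕ) : ℝ) + 1) ^ 2) * ϱ') ≤ 2 ∧
      2 * ϱ' ≤ c3 (d + 1) (ℓ + 1) ∧ 409600 * (((d + 1 : ℕ) : ℝ) + 1) ^ 2 * ϱ' ≤ 1 ∧
      epsCplx (d + 1) (ℓ + 1) ϱ' 0 ≤ 1 / 16 ∧
      ((d + 1 : ℕ) : ℝ) * (epsCplx (d + 1) (ℓ + 1) ϱ' 0 + tauCplx (d + 1) (ℓ + 1) α₀' 0 ϱ' 0) ≤ 1 / 16 ∧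
      Real.exp (4480 * (((d + 1 : ℕ) : ℝ) + 1) ^ 2 * (((d + 1 : ℕ) : ℝ) + 4) * α₀' + 240000 * (((d + 1 : ℕ) : ℝ) + 1) ^ 3 * ϱ') *
          (1 + 8 * (2097152 * (((d + 1 : ℕ) : ℝ) + 1) ^ 2) * ϱ') ≤ 2 ∧
      2 * ϱ' ≤ c3 (d + 1) (ℓ + 1) / 4 ∧
      -- (iii) the (3.58) window at `α_K := ϱ′`
      4096 * ((d + 1 : ℕ) : ℝ) * ϱ' ≤ 1 ∧
      -- (iv) the plaquette threshold, unfolded and folded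
      (∀ a : ℝ, 0 ≤ a → a ≤ a₁ →
        2 * (10 * ((ℓ : ℝ) + 1) * a) * (1 + 10 * ((ℓ : ℝ) + 1) * a) * Real.exp (4 * (10 * ((ℓ : ℝ) + 1) * a)) * ((ℓ : ℝ) + 1) ^ 4 < α₀') ∧
      ∀ {hd : 1 ≤ d + 1} {hL : Odd (ℓ + 1) ∧ 1 < ℓ + 1} {b₀ b₁ : ℝ} (i : KIdx d ℓ hd hL b₀ b₁) (a : ℝ), 0 ≤ a → a ≤ a₁ → Kpl i a * (kGeo i).L ^ 4 < α₀' := by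
  obtain ⟨α₀', a₁, h0, hle, ha₁, hQ, h3, h2, h4, hexp, hK, hpl, hpl'⟩ :=
    knitWindow_inhabited_le d ℓ (amax := min amax (alpha0W d ℓ)) (lt_min hamax (alpha0W_pos d ℓ))
  have hαW : α₀' ≤ alpha0W d ℓ := hle.trans (min_le_right _ _)
  exact ⟨α₀', bbW d ℓ, a₁, h0, hle.trans (min_le_left _ _), bbW_pos d ℓ, ha₁, hQ, h3, h2, h4, hexp, hK, hα8_knitV d ℓ hαW, hsmall'_knitV d ℓ hαW, hc₃'_knitV d ℓ,
    hϱ'1_knitV d ℓ, hE_knitV d ℓ, hdX_knitV d ℓ h0.le hαW, hsmall_knitV d ℓ h0.le hαW, hc₃_knitV d ℓ, hsm_knitV d ℓ, hpl, hpl'⟩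

end Literature.MathematicalPhysics.QuantumFieldTheory.Balaban1983to89.B9Eq380KnitVariationYNumerics

end
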